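import Summits.ABC.ABC.Theses.IsogenyGlueCongruence
import Summits.ABC.ABC.Theorems.IsogenyGlueCongruencePolyDegreeOfBoundedPrimesHeightCalibrationExact
import Summits.ABC.ABC.Theorems.IsogenyGlueCongruencePolyDegreeOfBoundedPrimesOptimalCalibrationItems
import Summits.ABC.ABC.Theorems.IsogenyGlueCongruencePolyDegreeOfBoundedPrimesHeightForms
import Literature.NumberTheory.EllipticCurves.SzpiroBGEquivalenceProofs
import Summits.ABC.ABC.Theorems.IsogenyGlueCongruencePolyHeightOfBoundedPrimesStubCorePosition
import Summits.ABC.ABC.Theorems.IsogenyGlueCongruencePolyHeightOfBoundedPrimesStubPolyGenSzpiroOfPolyStrongHall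
import Summits.ABC.ABC.Theorems.IsogenyGlueCongruencePolyHeightOfBoundedPrimesStubPolyStrongHallOfPolyGenSzpiro
import Summits.ABC.ABC.Theorems.IsogenyGlueCongruencePolyHeightOfBoundedPrimesStubSixLeOfPolyStrongHall

/-!
# Item `PolyHeightOfBoundedPrimes` (stmt-ABC-16006): position in the tree

The item B' of route IsogenyGlueCongruence is `A → H` with `A = DegreePrimesPolyBounded` (every prime
factor of the modular degree of a semistable `E/ℚ` is `≤ C·N^κ`) and

  `H`: `∃ σ C, ∀` semistable globally minimal elliptic `W/ℚ`, `max(|Δ_W|, |c₄(W)|³) ≤ C · N_W^σ`,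

the polynomial height conjecture (Frey 1989; Pasten–Shimura 2024, Conj. 3.1, restricted to semistable
curves; polynomial Szpiro in the `max(|Δ|, |c₄|³)` form with a FREE exponent). `H` is open in print.
This file records, in the item's own vocabulary and by one-line compositions of theorems already in
the tree, exactly where B' sits:

* **sufficient conditions** (each closes the item in one line the day it lands):
  `H` alone (`of_polyHeight`, hypothesis A idle) · the polynomial modular-degree statement `P`
  (`of_polyDegree`, through `P → H` = `polyHeight_of_polyDegree`, p102896) · crux B =
  `PolyDegreeOfBoundedPrimes` (`of_polyDegreeOfBoundedPrimes`) · the route target X =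
  `SemistableDegreeConjecture` (`of_semistableDegreeConjecture`) · the catalogued conjecture
  `GeneralizedSzpiroConjectureBG` (`of_generalizedSzpiroBG`, p111354) · the `≤`-form of abc and the
  summit `ABC` itself (`of_abcLe`, `of_ABC`, through Bombieri–Gubler Thm 12.5.12 =
  `abcLe_iff_generalizedSzpiroBG_holds`). So B' is a NECESSARY condition of the summit.
* **what B' gives back**: crux B modulo the route items `EdixhovenIntegrality`, `MazurKenkuBound` and
  Česnavičius' theorem (`polyDegreeOfBoundedPrimes_of_items`, `iff_polyDegreeOfBoundedPrimes_of_items`,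
  from p114386 / p116449) — B' is B with its Manin input removed; polynomial abc on Serre-normalised
  Frey triples granted A (`polyAbcNormalized`); the log-Faltings-height form (`iff_faltingsHeightForm`,
  p116768).
* **the height-form deciding chain** of the route (route-choice 05c66fb8: `closes … hBH hSharpH …`)
  elaborates: `abc_of_heightFormChain`, with `R' → R` unconditional
  (`sharpDegreeOfPolyDegree_of_sharpDegreeOfPolyHeight`).

Nothing here proves `H`; granted A no mechanism in print converts bounded SIZES of the primes dividing
`deg φ` into a bound on `deg φ` or on the height (tree negatives `Negative/AbstractStrengtheningFalse`,
p82575; crux-B notes `Cruxes/PolyDegreeOfBoundedPrimes/NOTES.md`). Supports stmt-ABC-16006.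

References: G. Frey, *Links between solutions of A − B = C and elliptic curves* (1989); H. Pasten,
*Shimura curves and the abc conjecture*, J. Number Theory 254 (2024) §3; E. Bombieri, W. Gubler,
*Heights in Diophantine Geometry* (2006) Thm 12.5.12; M. R. Murty, *Bounds for congruence primes* (1999).
-/

noncomputable section

-- single-conjunct summit ABC: the duplicate ABC.ABC is mandated (CONVENTIONS §2)
set_option linter.dupNamespace false

namespace Summit.ABC.ABC.Theorems.PolyHeightOfBoundedPrimes

open Literature.NumberTheory.EllipticCurves Literature.NumberTheory.EllipticCurves.ModularForms
open Literature.NumberTheory.DiophantineGeometry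
open Summit.ABC.ABC.Theses.IsogenyGlueCongruence

/-! ## Sufficient conditions: one-line closers -/

/-- **`H → B'`**: the polynomial height conjecture for semistable curves closes the item outright
(its hypothesis A is idle). [folklore] -/
theorem of_polyHeight
    (hH : ∃ σ C : ℝ, ∀ (W : WeierstrassCurve ℚ) [W.IsElliptic] [W.IsGloballyMinimal]
      [NeZero (W.conductorNorm ℤ)], W.IsSemistable ℤ →
      ((max |W.Δ| (|W.c₄| ^ 3) : ℚ) : ℝ) ≤ C * (W.conductorNorm ℤ : ℝ) ^ σ) :
    PolyHeightOfBoundedPrimes :=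
  fun _ ↦ hH

/-- **`P → B'`**: the polynomial modular-degree statement for semistable curves (the consequent of
crux B) closes the item, through the tree theorem `P → H` (`polyHeight_of_polyDegree`: Zagier's
identity, `(f,f) ≫ N^{1/4}`, Silverman's covolume inequality — all proved). [folklore] -/
theorem of_polyDegree
    (hP : ∃ κ C : ℝ, ∀ (W : WeierstrassCurve ℚ) [W.IsElliptic] [W.IsGloballyMinimal]
      [NeZero (W.conductorNorm ℤ)], W.IsSemistable ℤ →
      ∃ D : ModularParametrizationData W (W.conductorNorm ℤ),
        (D.modularDegree : ℝ) ≤ C * (W.conductorNorm ℤ : ℝ) ^ κ) :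
    PolyHeightOfBoundedPrimes :=
  fun _ ↦ polyHeight_of_polyDegree hP

/-- **`B → B'`** unconditionally: crux B (`PolyDegreeOfBoundedPrimes`, stmt-ABC-2046) implies the
item (`polyHeight_of_polyDegreeOfBoundedPrimes`, p102896). [folklore] -/
theorem of_polyDegreeOfBoundedPrimes (hB : PolyDegreeOfBoundedPrimes) : PolyHeightOfBoundedPrimes :=
  fun hA ↦ polyHeight_of_polyDegreeOfBoundedPrimes hB hA

/-- **`X → B'`**: the route target `SemistableDegreeConjecture` (stmt-ABC-2044) implies the item
(`X → P` at `ε = 1`, then `P → H`). [folklore] -/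
theorem of_semistableDegreeConjecture (hX : SemistableDegreeConjecture) : PolyHeightOfBoundedPrimes :=
  of_polyDegree ⟨2 + 1, hX 1 one_pos⟩

/-- **`GeneralizedSzpiroConjectureBG → B'`**: the catalogued Bombieri–Gubler generalized Szpiro
conjecture (`@[conjecture]`, `Literature.NumberTheory.EllipticCurves.GeneralizedSzpiroConjectureBG`)
implies the item (`polyHeight_of_generalizedSzpiroBG`, p111354, `σ = 7`).
[cite: BombieriGubler2006, Conj. 12.5.11 (p. 431)] -/
theorem of_generalizedSzpiroBG (h : GeneralizedSzpiroConjectureBG) : PolyHeightOfBoundedPrimes :=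
  of_polyHeight (polyHeight_of_generalizedSzpiroBG h)

/-- **abc (`≤`-form) `→ B'`**: the printed `≤`-form of the strong abc conjecture over `ℚ` implies the
item, through Bombieri–Gubler Thm 12.5.12 (a) ⟹ (c) (`abcLe_iff_generalizedSzpiroBG_holds`, proved in
the tree). [cite: BombieriGubler2006, Thm. 12.5.12] -/
theorem of_abcLe
    (h : ∀ ε : ℝ, 0 < ε → ∃ C : ℝ, ∀ a b c : ℕ, IsABCTriple a b c →
      (c : ℝ) ≤ C * ((rad a b c : ℕ) : ℝ) ^ (1 + ε)) :
    PolyHeightOfBoundedPrimes :=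
  of_generalizedSzpiroBG (abcLe_iff_generalizedSzpiroBG_holds.mp h)

/-- **`ABC → B'`: the item is a necessary condition of the summit.** The summit statement `ABC`
(strict form with `0 < C`) gives the `≤`-form and hence the item. Consequently a refutation of B'
would refute the summit, and no evidence against B' short of evidence against abc can exist.
[cite: BombieriGubler2006, Thm. 12.5.12] -/
theorem of_ABC (h : ABC) : PolyHeightOfBoundedPrimes := by
  refine of_abcLe fun ε hε ↦ ?_
  obtain ⟨C, -, hC⟩ := (ABC_iff.mp h) ε hε
  exact ⟨C, fun a b c habc ↦ (hC a b c habc).le⟩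

/-! ## What the item gives back -/

/-- **`B' → B` modulo the route items `EdixhovenIntegrality` (stmt-ABC-15990, verbatim the Literature
fact `edixhoven_int_of_neronLattice_eq_smul_periodLattice`), `MazurKenkuBound` (stmt-ABC-15125) and
Česnavičius 2018 Thm 1.2 (`abs_maninConstant_eq_one_of_isSemistable`, universally closed)**: the item
returns crux B (`polyDegreeOfBoundedPrimes_of_polyHeight_of_items`, p116449; hypothesis A feeds B').
[cite: MurtyCongruencePrimes1999, Thm. 1 (ii) and §2] -/
theorem polyDegreeOfBoundedPrimes_of_items (hEd : EdixhovenIntegrality)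
    (hCes : ∀ {W' : WeierstrassCurve ℚ} {N' : ℕ} [NeZero N']
      (D' : ModularParametrizationData W' N'), D'.abs_maninConstant_eq_one_of_isSemistable)
    (hMK : MazurKenkuBound) (hB' : PolyHeightOfBoundedPrimes) : PolyDegreeOfBoundedPrimes :=
  fun hA ↦ polyDegreeOfBoundedPrimes_of_polyHeight_of_items hEd hCes hMK (hB' hA) hA

/-- **`B' ↔ B` modulo `EdixhovenIntegrality`, Česnavičius and `MazurKenkuBound`** (item form of
`polyDegreeOfBoundedPrimes_iff_polyHeight_of_mazurKenku`, p114386): the height-form re-cut B' is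
crux B with its Manin input removed, nothing more and nothing less. [cite: PastenShimura2024, §3 p. 13] -/
theorem iff_polyDegreeOfBoundedPrimes_of_items (hEd : EdixhovenIntegrality)
    (hCes : ∀ {W' : WeierstrassCurve ℚ} {N' : ℕ} [NeZero N']
      (D' : ModularParametrizationData W' N'), D'.abs_maninConstant_eq_one_of_isSemistable)
    (hMK : MazurKenkuBound) : PolyHeightOfBoundedPrimes ↔ PolyDegreeOfBoundedPrimes :=
  ⟨polyDegreeOfBoundedPrimes_of_items hEd hCes hMK, of_polyDegreeOfBoundedPrimes⟩

/-- The same equivalence over the Literature facts (`edixhoven_int_of_neronLattice_eq_smul_periodLattice`,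
Česnavičius, `PastenShimura2024_minimalDegree_le_163_mul`), `Iff.symm` of
`polyDegreeOfBoundedPrimes_iff_polyHeight_of_facts` (p114386). [cite: PastenShimura2024, §3 p. 13] -/
theorem iff_polyDegreeOfBoundedPrimes_of_facts
    (hEd : edixhoven_int_of_neronLattice_eq_smul_periodLattice)
    (hCes : ∀ {W' : WeierstrassCurve ℚ} {N' : ℕ} [NeZero N']
      (D' : ModularParametrizationData W' N'), D'.abs_maninConstant_eq_one_of_isSemistable)
    (h163 : PastenShimura2024_minimalDegree_le_163_mul) :
    PolyHeightOfBoundedPrimes ↔ PolyDegreeOfBoundedPrimes :=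
  (polyDegreeOfBoundedPrimes_iff_polyHeight_of_facts hEd hCes h163).symm

/-- **Log-Faltings-height form of the item**: B' says equivalently that crux A implies
`h_F(W) ≤ a · log N_W + b` for all semistable globally minimal elliptic `W/ℚ`
(`faltingsHeight_le_log_iff_polyHeight`, p116768, Silverman 1986; known in print only
`h < (1/48 + ε) N log N`, Pasten–Shimura 2024 Thm 1.9). [cite: Silverman1986, Prop. 1.1 and Cor. 2.3] -/
theorem iff_faltingsHeightForm :
    PolyHeightOfBoundedPrimes ↔ (DegreePrimesPolyBounded →
      ∃ a b : ℝ, ∀ (W : WeierstrassCurve ℚ) [W.IsElliptic] [W.IsGloballyMinimal]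
        [NeZero (W.conductorNorm ℤ)], W.IsSemistable ℤ →
        W.faltingsHeight ≤ a * Real.log (W.conductorNorm ℤ) + b) :=
  ⟨fun hB' hA ↦ faltingsHeight_le_log_iff_polyHeight.mpr (hB' hA),
    fun h hA ↦ faltingsHeight_le_log_iff_polyHeight.mp (h hA)⟩

/-- **`B' → A →` polynomial abc on Serre-normalised triples** (`polyAbcNormalized_of_polyHeight`,
p111354): `(AB(A+B))² ≤ C · N^σ` for coprime `A ≡ −1 (mod 4)`, `32 ∣ B`, `N` the conductor of the
Frey curve. [cite: BombieriGubler2006, Ex. 12.5.10] -/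
theorem polyAbcNormalized (hB' : PolyHeightOfBoundedPrimes) (hA : DegreePrimesPolyBounded) :
    ∃ σ C : ℝ, ∀ A B : ℤ, IsCoprime A B → A * B * (A + B) ≠ 0 → A ≡ -1 [ZMOD 4] → (32 : ℤ) ∣ B →
      (((A * B * (A + B)) ^ 2 : ℤ) : ℝ) ≤ C * ((freyCurve A B).conductorNorm ℤ : ℝ) ^ σ :=
  polyAbcNormalized_of_polyHeight (hB' hA)

/-! ## The height-form deciding chain -/

/-- **`R' → R` unconditionally**: the height-form residual `SharpDegreeOfPolyHeight` (stmt-ABC-16009)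
implies the degree-form residual `SharpDegreeOfPolyDegree` (stmt-ABC-10895), through `P → H`.
[folklore] -/
theorem sharpDegreeOfPolyDegree_of_sharpDegreeOfPolyHeight (hR' : SharpDegreeOfPolyHeight) :
    SharpDegreeOfPolyDegree :=
  fun hP ↦ hR' (polyHeight_of_polyDegree hP)

/-- **`X → R'`**: the target closes the height-form residual in one line (as `stub_ofTarget` does
for R, p96259). [folklore] -/
theorem sharpDegreeOfPolyHeight_of_semistableDegreeConjecture (hX : SemistableDegreeConjecture) :
    SharpDegreeOfPolyHeight :=
  fun _ ↦ hX

/-- **The height-form deciding chain elaborates**: with B' and R' in place of B and R the route's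
deciding composition `hFrame hP (hSharpH (hBH (hGlueU hU hJ (hHofMK hMK hMod))))` (route-choice
05c66fb8) typechecks against the sub-problem statement `ABC` — no Manin-constant input is consumed.
[folklore] -/
theorem abc_of_heightFormChain (hU : EllipticGluingPrimeBound) (hJ : ModularJacobianMultipliers)
    (hMK : MazurKenkuBound) (hMod : ModularDatumExists)
    (hHofMK : SemistableHeightPolyBoundOfMazurKenku) (hGlueU : DegreePrimesOfGluingBound)
    (hBH : PolyHeightOfBoundedPrimes) (hSharpH : SharpDegreeOfPolyHeight)
    (hP : PeterssonLowerBound) (hFrame : FrameOverPetersson) : ABC :=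
  hFrame hP (hSharpH (hBH (hGlueU hU hJ (hHofMK hMK hMod))))

/-! ## The Hall bridge (crux line `Sketch`, idea `mordell-twist-cm-height`, 2026-08-16)

Appended by the line lead (prover-line-stmt-ABC-16006-0). The line transfers `H` to **C⁺ = polynomial
strong Hall** — every primitive solution of `x³ − y² = z ≠ 0` (Bombieri–Gubler 12.5.2) has
`max(|x|³, |z|) ≤ C · rad(z)^A` — through **polynomial generalized Szpiro over `ℤ`-models**
(`max(|Δ|, |c₄|³) ≤ C · N^σ` for every `ℤ`-model of an elliptic curve over `ℚ` minimal at every place;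
B–G Conj. 12.5.11 with a free exponent). All glue is landed as registered stubs of the crux
(`MordellTwist.stub_*`, p120857, p121114, p121219, p121421); the compositions below record the result by
name: `of_polyGenSzpiroInt`, `of_polyStrongHall` (conditional closers), `polyStrongHall_iff_polyGenSzpiroInt`
(the transfer target is EXACTLY polynomial generalized Szpiro over `ℤ`-models — free-exponent B–G
Thm 12.5.12 (b) ⟺ (c)); the floor `A ≥ 6` of any witness of C⁺ (Danilov) is
`MordellTwist.six_le_of_polyStrongHall` (p121219). C⁺ itself is open
(⟸ abc: `MordellTwist.polyStrongHall_of_abcLe`); the line closes the item modulo C⁺ and nothing less. -/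

open UniqueFactorizationMonoid

/-- **`ℤ`-model polynomial generalized Szpiro ⟹ `H`** (free-exponent form of
`polyHeight_of_generalizedSzpiroBG`, p111354): read `H` on the integral global minimal model
`integralModelInt W`. [folklore] -/
theorem polyHeight_of_polyGenSzpiroInt
    (h : ∃ σ C : ℝ, ∀ W₀ : WeierstrassCurve ℤ, (W₀.baseChange ℚ).IsElliptic →
      (∀ v : IsDedekindDomain.HeightOneSpectrum ℤ, (W₀.baseChange ℚ).IsMinimalAt v) →
      ((max |W₀.Δ| (|W₀.c₄| ^ 3) : ℤ) : ℝ) ≤ C * ((W₀.baseChange ℚ).conductorNorm ℤ : ℝ) ^ σ) :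
    ∃ σ C : ℝ, ∀ (W : WeierstrassCurve ℚ) [W.IsElliptic] [W.IsGloballyMinimal]
      [NeZero (W.conductorNorm ℤ)], W.IsSemistable ℤ →
      ((max |W.Δ| (|W.c₄| ^ 3) : ℚ) : ℝ) ≤ C * (W.conductorNorm ℤ : ℝ) ^ σ := by
  obtain ⟨σ, C, hC⟩ := h
  refine ⟨σ, C, fun W _ _ _ _ ↦ ?_⟩
  set W₀ : WeierstrassCurve ℤ := WeierstrassCurve.integralModelInt W with hW₀def
  have hW₀ : W₀.baseChange ℚ = W := WeierstrassCurve.baseChange_integralModelInt W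
  have hell : (W₀.baseChange ℚ).IsElliptic := by rw [hW₀]; infer_instance
  have hmin : ∀ v : IsDedekindDomain.HeightOneSpectrum ℤ, (W₀.baseChange ℚ).IsMinimalAt v := fun v ↦ by
    rw [hW₀]; exact WeierstrassCurve.IsGloballyMinimal.isMinimalAt_int W v
  have hσ := hC W₀ hell hmin
  rw [hW₀] at hσ
  have hq : (max |W.Δ| (|W.c₄| ^ 3) : ℚ) = ((max |W₀.Δ| (|W₀.c₄| ^ 3) : ℤ) : ℚ) := by
    rw [← WeierstrassCurve.cast_integralModelInt_Δ W, ← WeierstrassCurve.cast_integralModelInt_c₄ W]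
    push_cast
    rfl
  rw [hq, Rat.cast_intCast]
  exact hσ

/-- **`ℤ`-model polynomial generalized Szpiro ⟹ B′** (conditional closer; hypothesis A idle). [folklore] -/
theorem of_polyGenSzpiroInt
    (h : ∃ σ C : ℝ, ∀ W₀ : WeierstrassCurve ℤ, (W₀.baseChange ℚ).IsElliptic →
      (∀ v : IsDedekindDomain.HeightOneSpectrum ℤ, (W₀.baseChange ℚ).IsMinimalAt v) →
      ((max |W₀.Δ| (|W₀.c₄| ^ 3) : ℤ) : ℝ) ≤ C * ((W₀.baseChange ℚ).conductorNorm ℤ : ℝ) ^ σ) :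
    PolyHeightOfBoundedPrimes :=
  of_polyHeight (polyHeight_of_polyGenSzpiroInt h)

/-- **Registered transfer stub `stub_polyHeightOfBoundedPrimes_of_polyStrongHall`: C⁺ ⟹ B′ — polynomial
strong Hall closes the item** (the line's composition, by name: glue `MordellTwist.polyGenSzpiro_of_polyStrongHall`,
p121114, then `of_polyGenSzpiroInt`). The item is thereby closed MODULO the open conjecture C⁺ — a consequence
of abc (`MordellTwist.polyStrongHall_of_abcLe`) — and modulo nothing else. [cite: BombieriGubler2006, Thm. 12.5.12 (b) ⟹ (c)] -/
theorem stub_polyHeightOfBoundedPrimes_of_polyStrongHall :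
    (∃ A C : ℝ, ∀ x y z : ℤ, IsPrimitiveHallSolution x y z →
      ((max (|x| ^ 3) |z| : ℤ) : ℝ) ≤ C * ((radical z.natAbs : ℕ) : ℝ) ^ A) → PolyHeightOfBoundedPrimes :=
  fun h ↦ of_polyGenSzpiroInt (MordellTwist.polyGenSzpiro_of_polyStrongHall h)

/-- **C⁺ ⟹ B′** (curried form of the registered transfer stub
`stub_polyHeightOfBoundedPrimes_of_polyStrongHall`). [cite: BombieriGubler2006, Thm. 12.5.12 (b) ⟹ (c)] -/
theorem of_polyStrongHall
    (h : ∃ A C : ℝ, ∀ x y z : ℤ, IsPrimitiveHallSolution x y z →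
      ((max (|x| ^ 3) |z| : ℤ) : ℝ) ≤ C * ((radical z.natAbs : ℕ) : ℝ) ^ A) :
    PolyHeightOfBoundedPrimes :=
  stub_polyHeightOfBoundedPrimes_of_polyStrongHall h

/-- **The transfer target is exactly polynomial generalized Szpiro over `ℤ`-models**: free-exponent
Bombieri–Gubler Thm 12.5.12 (b) ⟺ (c), both directions landed as registered stubs of the line
(`MordellTwist.polyGenSzpiro_of_polyStrongHall`, p121114: exponent `max(A,6)`;
`MordellTwist.polyStrongHall_of_polyGenSzpiro`, p121421: exponent `2·max(σ,0)` through the model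
`(c₄, c₆) = (6⁴x, 6⁶y)` and `N ∣ 2⁸3⁵ rad(z)²`). [cite: BombieriGubler2006, Thm. 12.5.12] -/
theorem polyStrongHall_iff_polyGenSzpiroInt :
    (∃ A C : ℝ, ∀ x y z : ℤ, IsPrimitiveHallSolution x y z →
      ((max (|x| ^ 3) |z| : ℤ) : ℝ) ≤ C * ((radical z.natAbs : ℕ) : ℝ) ^ A) ↔
    (∃ σ C : ℝ, ∀ W₀ : WeierstrassCurve ℤ, (W₀.baseChange ℚ).IsElliptic →
      (∀ v : IsDedekindDomain.HeightOneSpectrum ℤ, (W₀.baseChange ℚ).IsMinimalAt v) →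
      ((max |W₀.Δ| (|W₀.c₄| ^ 3) : ℤ) : ℝ) ≤ C * ((W₀.baseChange ℚ).conductorNorm ℤ : ℝ) ^ σ) :=
  ⟨MordellTwist.polyGenSzpiro_of_polyStrongHall, MordellTwist.polyStrongHall_of_polyGenSzpiro⟩

end Summit.ABC.ABC.Theorems.PolyHeightOfBoundedPrimes

end
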